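import Summits.CriticalPhenomena.PercolationContinuityZ3.Theorems.PercNearOneGluingNoHeavyRsw3InvasionUniqueCluster
import HarnessLib

/-!
# RSW3 lane (P2, gen 26): INVASION PERCOLATION VIII — the `ℤ³` summary

builds on p205010 (kernel theorem, internal audit signed; external expert review pending) — the zero-density / `x_n > p_c` statements use it
(`θ(p_c(ℤ³)) = 0`); the `limsup` statements use only CCN 1985 + Barsky–Grimmett–Newman 1991 (tree).
Status sentence for p205010: "θ(p_c) = 0 on ℤ^d, all d ≥ 2 — kernel-verified (Lean 4/Mathlib, standard axioms); internal adversarial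
audit SIGNED 2026-08-20 04:29Z; external expert review pending."

Cell `prim-rsw3`, prover seat `prim-rsw3-p2` (gen 26), memo `run/shared/lean/prim/rsw3/P2-RSWLITE.md` §33.  Support file
(`--supports stmt-CriticalPhenomena-4575`); no definitions, no named facts, no sorries.  One-screen statements, for `d = 3`, of the
invasion-percolation package (files I–VII): `μ = labelMeasure (Site 3)` = i.i.d. uniform labels on the bonds of `ℤ³`,
`x_n(U) = acceptedLabel (zdGraph 3) U 0 n` = label of the `n`-th bond invaded from the origin, `I_∞(U) = invadedRegion (zdGraph 3) U 0`,
`p_c = criticalProb (zdGraph 3) 0`, `Λ_N = box 3 N`.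

* `invasion_selfOrganised_Z3` — a.s.: for every `y ∈ [0,1]`, `p_c < y ⇒ x_n ≤ y` eventually, and `y < p_c ⇒ x_n > y` infinitely often
  (`limsup x_n = p_c(ℤ³)`; CCN Thm 3.2 + BGN).
* `invasion_eventually_le_iff_Z3`, `invasion_frequently_lt_iff_Z3` — (a.s. `x_n ≤ y` ev.) ⟺ `p_c < y`; (a.s. `x_n > y` i.o.) ⟺ `y ≤ p_c`.
* `invasion_frequently_exceeds_criticalProb_Z3` — a.s. `x_n > p_c(ℤ³)` for infinitely many `n` (p205010).
* `invasion_maxLabel_law_Z3` — `μ{∀ n, x_n ≤ y} = θ(y)`: the law of the largest invaded label is `θ`.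
* a.s. `|I_∞ ∩ Λ_N| / (2N+1)³ → 0` (CCN Thm 5.2, unconditional by p205010) is file V's `ae_tendsto_invadedDensity_zero_Z3` (not restated).
* `invasion_meanDensity_zero_Z3` — `|Λ_N|⁻¹ Σ_{x∈Λ_N} μ{x ∈ I_∞} → 0`.
* `invasion_eventually_in_infinite_cluster_Z3` — for `y > p_c`: a.s. all but finitely many invaded vertices lie in THE infinite `y`-cluster.

References: J. T. Chayes, L. Chayes, C. M. Newman, Comm. Math. Phys. 101 (1985) 383–407 [ChayesChayesNewman1985]; D. J. Barsky, G. R. Grimmett,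
C. M. Newman, PTRF 90 (1991) [BarskyGrimmettNewman1991].
-/

noncomputable section

namespace Summit.CriticalPhenomena.PercolationContinuityZ3.Theorems.Rsw3

open Finset MeasureTheory Filter Topology Literature.Probability.LatticeModels Literature.Probability.Percolation
open Literature.Probability.Percolation.Invasion

/-- **Invasion percolation on `ℤ³` self-organises to `p_c(ℤ³)`**: almost surely, for every level `y ∈ [0,1]`, if `p_c < y` then `x_n ≤ y`
for all large `n`, and if `y < p_c` then `x_n > y` for infinitely many `n`. [cite: ChayesChayesNewman1985, Thm 3.2] -/
theorem invasion_selfOrganised_Z3 :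
    ∀ᵐ U ∂(labelMeasure (Site 3)),
      (∀ y : unitInterval, criticalProb (zdGraph 3) (0 : Site 3) < y →
        ∀ᶠ n in atTop, acceptedLabel (zdGraph 3) U 0 n ≤ y) ∧
      (∀ y : unitInterval, (y : ℝ) < criticalProb (zdGraph 3) (0 : Site 3) →
        ∃ᶠ n in atTop, (y : ℝ) < acceptedLabel (zdGraph 3) U 0 n) :=
  ae_acceptedLabel_selfOrganised (d := 3) (by norm_num)

/-- `ℤ³`: (a.s. `x_n ≤ y` eventually) ⟺ `p_c(ℤ³) < y`. [cite: ChayesChayesNewman1985, Thm 3.2] -/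
theorem invasion_eventually_le_iff_Z3 (y : unitInterval) :
    (∀ᵐ U ∂(labelMeasure (Site 3)), ∀ᶠ n in atTop, acceptedLabel (zdGraph 3) U 0 n ≤ y) ↔
      criticalProb (zdGraph 3) (0 : Site 3) < y :=
  ae_eventually_acceptedLabel_le_iff (d := 3) (by norm_num) y

/-- `ℤ³`: (a.s. `x_n > y` infinitely often) ⟺ `y ≤ p_c(ℤ³)`. [cite: ChayesChayesNewman1985, Thm 3.2] -/
theorem invasion_frequently_lt_iff_Z3 (y : unitInterval) :
    (∀ᵐ U ∂(labelMeasure (Site 3)), ∃ᶠ n in atTop, (y : ℝ) < acceptedLabel (zdGraph 3) U 0 n) ↔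
      (y : ℝ) ≤ criticalProb (zdGraph 3) (0 : Site 3) :=
  ae_frequently_lt_acceptedLabel_iff (d := 3) (by norm_num) y

/-- **`ℤ³`: almost surely the invasion accepts labels above `p_c(ℤ³)` infinitely often** (p205010). [cite: ChayesChayesNewman1985, Thm 3.2 (discussion)] -/
theorem invasion_frequently_exceeds_criticalProb_Z3 :
    ∀ᵐ U ∂(labelMeasure (Site 3)), ∃ᶠ n in atTop, criticalProb (zdGraph 3) (0 : Site 3) < acceptedLabel (zdGraph 3) U 0 n :=
  ae_frequently_criticalProb_lt_acceptedLabel (d := 3) (by norm_num)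

/-- **`ℤ³`: the law of the largest invaded label is `θ`**: `μ{∀ n, x_n ≤ y} = θ_{ℤ³}(y)`. [cite: ChayesChayesNewman1985, Thm 3.1] -/
theorem invasion_maxLabel_law_Z3 (y : unitInterval) :
    (labelMeasure (Site 3)).real {U | ∀ n, acceptedLabel (zdGraph 3) U 0 n ≤ y} = theta (zdGraph 3) (0 : Site 3) y :=
  labelMeasure_real_forall_acceptedLabel_le (d := 3) (by norm_num) y

/-- **`ℤ³`: the mean invaded density tends to zero**: `|Λ_N|⁻¹ Σ_{x ∈ Λ_N} μ{x is eventually invaded} → 0`.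
[cite: ChayesChayesNewman1985, Thm 5.2 (Y = 0 when P_∞(p_c) = 0)] -/
theorem invasion_meanDensity_zero_Z3 :
    Tendsto (fun N : ℕ => (∑ x ∈ box 3 N, (labelMeasure (Site 3)).real {U | x ∈ invadedRegion (zdGraph 3) U 0}) /
      (2 * (N : ℝ) + 1) ^ 3) atTop (𝓝 0) :=
  tendsto_average_prob_mem_invadedRegion_zero (d := 3) (by norm_num)

/-- **`ℤ³`: for every `y > p_c(ℤ³)`, almost surely all but finitely many invaded vertices lie in the (unique) infinite `y`-cluster** —
any two of them are joined by a `y`-open path. [cite: ChayesChayesNewman1985, Thm 3.2 and §5] -/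
theorem invasion_eventually_in_infinite_cluster_Z3 (y : unitInterval) (hy : criticalProb (zdGraph 3) (0 : Site 3) < y) :
    ∀ᵐ U ∂(labelMeasure (Site 3)), ∃ F : Set (Site 3), F.Finite ∧
      (∀ x ∈ invadedRegion (zdGraph 3) U 0 \ F, configOfLabels (y : ℝ) U (zdGraph 3) ∈ percolatesAt x) ∧
      ∀ x ∈ invadedRegion (zdGraph 3) U 0 \ F, ∀ x' ∈ invadedRegion (zdGraph 3) U 0 \ F,
        configOfLabels (y : ℝ) U (zdGraph 3) ∈ openConn x x' :=
  ae_exists_finite_invadedRegion_joined (d := 3) (by norm_num) y hy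

end Summit.CriticalPhenomena.PercolationContinuityZ3.Theorems.Rsw3
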